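import Summits.ValiantsHypothesis.ValiantsHypothesis.Theorems.LacunarySymmetroidMatrixDescartesCensusDoorA34DefiniteEndLetterTwoDichotomy

/-!
# `MatrixDescartes` census — DOOR A at `(3,4)`, flag ladder one size down: the `(2,3)` definite-end-letter law at the TOP end (mirror), and the
# `m = 3` reading of the plane dichotomy — a CORRELATED PLANE carries at most three kernels of a definite-bottom `(3,3)` row on `d₂ < 2d₁`

HONEST FRAMING.  Object-search cell `pub-symmetroid`, door-A seat `val-sym-door-p3` (g24); helper file `--supports` the OPEN typed statement
`Theses.LacunarySymmetroid.DoorA34 = PosRootLawAt 3 4 18` (stmt-ValiantsHypothesis-19980), asserted nowhere here.  Part 4 of the `(2,3)`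
definite-end-letter files (`…DefiniteEndLetterTwoCalculus`, `…DefiniteEndLetterTwo`, `…DefiniteEndLetterTwoDichotomy`).

* `pencil_reverse_two`, **`no_five_psdSingular_of_posDef_top`** — the MIRROR law: `S₂ ≻ 0`, `d₀ = 0 < d₁ < d₂ < 2d₁`, `S₀, S₁` real symmetric
  `2 × 2` ⇒ at most FOUR positive PSD-singular points of `S₀ + x^{d₁}S₁ + x^{d₂}S₂` (`x ↦ 1/x` turns it into the bottom-end law on the exponents
  `(0, d₂ − d₁, d₂)`, `2(d₂ − d₁) < d₂ ⟺ d₂ < 2d₁`).  With `no_five_psdSingular_of_posDef` this is the SIDE RULE of DOOR-A34-P3G7 §2 in the kernel: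
  a pure-λ_min FIVE of a `(2,3)` row needs its definite end letter at the bottom when `d₂ < 2d₁` and at the top when `d₂ > 2d₁`, never the
  other way round (census of record 41/41).
* `eval_pencil_compress`, **`no_four_kernels_in_correlated_plane`** — the `m = 3` COROLLARY: for a real symmetric `3 × 3` row
  `F = 1 + x^{d₁}S₁ + x^{d₂}S₂` with `d₁ < d₂ < 2d₁` (the OPEN chambers III/IV of Claim L) and a plane `W` (orthonormal rows `P`, `PPᵀ = 1`) whose
  compressed letters `PS₁Pᵀ, PS₂Pᵀ` are CORRELATED, there are no four points `0 < x₀ < ⋯ < x₃` with `F(x_i) ⪰ 0` and a kernel vector in `W`: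
  **a correlated plane carries at most THREE of the kernels of a pure-λ_min configuration** (the compression `PFPᵀ` is a `(2,3)` row with bottom
  letter `1` to which `no_four_psdSingular_of_correlated` applies).  Compare the incidence laws of record `Census.card_roots_kernel_orthogonal_le_nine`
  (`(3,4)`, any plane, nine) — here the bound depends on a MAGNITUDE datum of the letters (the sign of `⟨(S₁|_W)⁰, (S₂|_W)⁰⟩`), which is what the
  root-local incidence package (DOOR-A34-P3G23 §3b) lacks.

Nothing here bounds `ζ_sym(3,3)` or `ζ_sym(3,4)`; `DoorA34`, Claim L on `d₂ < 2d₁` and `MatrixDescartes` (stmt-ValiantsHypothesis-18050) stay OPEN;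
nothing on `VP ≠ VNP`.  [folklore] `x ↦ 1/x`, compressions of positive semidefinite matrices; elementary.
-/

set_option linter.dupNamespace false

namespace Summit.ValiantsHypothesis.ValiantsHypothesis.Theorems.LacunarySymmetroidMatrixDescartes.Census

namespace EndLetterTwo

open Polynomial Finset Set
open scoped BigOperators Polynomial Matrix

/-! ## 8. The MIRROR law: a positive definite TOP letter and `d₂ < 2d₁` -/

/-- **Reversal of the three-letter `2 × 2` pencil.**  With `d₀ = 0 ≤ d₁ ≤ d₂`: for `y > 0`,
`∑ y^{d'_l} S'_l = y^{d₂} • ∑ (y⁻¹)^{d_l} S_l` where `d' = (0, d₂ − d₁, d₂)` and `S' = (S₂, S₁, S₀)`. [folklore] -/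
theorem pencil_reverse_two (d : Fin 3 → ℕ) (S : Fin 3 → Matrix (Fin 2) (Fin 2) ℝ) (h0 : d 0 = 0) (h01 : d 1 ≤ d 2) {y : ℝ} (hy : 0 < y) :
    (∑ l, y ^ (![0, d 2 - d 1, d 2] : Fin 3 → ℕ) l • (![S 2, S 1, S 0] : Fin 3 → Matrix (Fin 2) (Fin 2) ℝ) l)
      = y ^ d 2 • ∑ l, (y⁻¹) ^ d l • S l := by
  rw [Fin.sum_univ_three, Fin.sum_univ_three]
  simp only [Matrix.cons_val_zero, Matrix.cons_val_one, Matrix.cons_val_two, Matrix.vecHead, Matrix.vecTail,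
    Function.comp_apply, Fin.succ_zero_eq_one, h0, pow_zero, one_smul, smul_add, smul_smul]
  have hy0 : y ≠ 0 := hy.ne'
  have e1 : y ^ d 2 * y⁻¹ ^ d 1 = y ^ (d 2 - d 1) := by
    rw [inv_pow, pow_sub₀ _ hy0 h01]
  have e2 : y ^ d 2 * y⁻¹ ^ d 2 = 1 := by rw [inv_pow, mul_inv_cancel₀ (pow_ne_zero _ hy0)]
  rw [e1, e2, one_smul]
  abel

/-- **THE (2,3) DEFINITE-END-LETTER LAW, TOP END.**  Let `F(x) = S₀ + x^{d₁}S₁ + x^{d₂}S₂` be a real symmetric `2 × 2` three-letter pencil with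
`d₀ = 0 < d₁ < d₂ < 2d₁` and a positive definite TOP letter `S₂ ≻ 0`.  Then there are no five points `0 < x₀ < ⋯ < x₄` at which `F` is positive
semidefinite and singular.  (Mirror `x ↦ 1/x`: `x^{−d₂}F(x)` is the pencil with letters `(S₂, S₁, S₀)` on the exponents `(0, d₂ − d₁, d₂)`, and
`2(d₂ − d₁) < d₂ ⟺ d₂ < 2d₁`; then `no_five_psdSingular_of_posDef`.)  Together with the bottom-end law this is the SIDE RULE of DOOR-A34-P3G7 §2:
a pure-λ_min five needs its definite end letter on the side `d₂ < 2d₁` (bottom) resp. `d₂ > 2d₁` (top) — never the other one. [folklore] -/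
theorem no_five_psdSingular_of_posDef_top (d : Fin 3 → ℕ) (S : Fin 3 → Matrix (Fin 2) (Fin 2) ℝ) (hS : ∀ l, (S l).IsSymm)
    (hP2 : (S 2).PosDef) (h0 : d 0 = 0) (hd1 : d 1 < d 2) (hd : d 2 < 2 * d 1)
    {x : Fin 5 → ℝ} (hx0 : 0 < x 0) (hx : StrictMono x)
    (hpsd : ∀ i, (∑ l, x i ^ d l • S l).PosSemidef) (hdet : ∀ i, (∑ l, x i ^ d l • S l).det = 0) : False := by
  have hxpos : ∀ i, 0 < x i := fun i => lt_of_lt_of_le hx0 (hx.monotone (Fin.zero_le i))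
  set d' : Fin 3 → ℕ := ![0, d 2 - d 1, d 2] with hd'
  set S' : Fin 3 → Matrix (Fin 2) (Fin 2) ℝ := ![S 2, S 1, S 0] with hS'
  have hS'symm : ∀ l, (S' l).IsSymm := by
    intro l; fin_cases l
    · exact hS 2
    · exact hS 1
    · exact hS 0
  have hP0' : (S' 0).PosDef := hP2
  -- reversed points y_i = 1 / x_{4−i}
  set y : Fin 5 → ℝ := fun i => (x (Fin.rev i))⁻¹ with hy
  have hypos : ∀ i, 0 < y i := fun i => inv_pos.mpr (hxpos _)
  have hymono : StrictMono y := fun i j hij => by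
    show (x (Fin.rev i))⁻¹ < (x (Fin.rev j))⁻¹
    exact (inv_lt_inv₀ (hxpos _) (hxpos _)).mpr (hx (Fin.rev_strictAnti hij))
  have hrev : ∀ i, (∑ l, y i ^ d' l • S' l) = y i ^ d 2 • ∑ l, x (Fin.rev i) ^ d l • S l := by
    intro i
    rw [hd', hS', pencil_reverse_two d S h0 hd1.le (hypos i)]
    simp [hy]
  refine no_five_psdSingular_of_posDef d' S' hS'symm hP0' (by simp [hd']) (by simp [hd']; omega) (by simp [hd']; omega)
    (hypos 0) hymono (fun i => ?_) (fun i => ?_)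
  · rw [hrev]; exact (hpsd _).smul (pow_nonneg (hypos i).le _)
  · rw [hrev, Matrix.det_smul, hdet, mul_zero]

/-! ## 9. The m = 3 reading in the kernel: a CORRELATED PLANE carries at most three kernels of a definite-bottom (3,3) row on `d₂ < 2d₁` -/

/-- Evaluation form of a rectangular compression of a three-letter pencil: `∑ x^{d l} • (P S_l Q) = P (∑ x^{d l} • S_l) Q`. [folklore] -/
theorem eval_pencil_compress (d : Fin 3 → ℕ) (S : Fin 3 → Matrix (Fin 3) (Fin 3) ℝ) (P : Matrix (Fin 2) (Fin 3) ℝ)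
    (Q : Matrix (Fin 3) (Fin 2) ℝ) (x : ℝ) :
    (∑ l, x ^ d l • (P * S l * Q)) = P * (∑ l, x ^ d l • S l) * Q := by
  simp only [Fin.sum_univ_three, Matrix.mul_add, Matrix.add_mul, Matrix.mul_smul, Matrix.smul_mul]

/-- **A CORRELATED PLANE CARRIES AT MOST THREE KERNELS (m = 3 corollary of the plane dichotomy).**  Let `F(x) = 1 + x^{d₁}S₁ + x^{d₂}S₂` be a real
symmetric `3 × 3` three-letter pencil with `d₀ = 0`, `d₁ < d₂ < 2d₁` (the OPEN chambers III/IV of Claim L), and let `P` be a `2 × 3` matrix with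
orthonormal rows (`P Pᵀ = 1`: the plane `W = row space of P`).  If the compressed letters `P S₁ Pᵀ`, `P S₂ Pᵀ` are CORRELATED
(`(a₀₀ − a₁₁)(b₀₀ − b₁₁) + 4a₀₁b₀₁ ≥ 0`), then there are no four points `0 < x₀ < ⋯ < x₃` at which `F` is positive semidefinite with a kernel vector
IN THE PLANE (`F(x_i)·(Pᵀ v_i) = 0`, `v_i ≠ 0`): the compression `P F Pᵀ = 1 + x^{d₁}(PS₁Pᵀ) + x^{d₂}(PS₂Pᵀ)` would be PSD-singular there, against
`no_four_psdSingular_of_correlated`.  A pure-λ_min nine therefore places at most three of its nine kernels in any correlated plane (any plane holds at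
most five by the Descartes count of the compressed `(2,3)` row). [folklore] -/
theorem no_four_kernels_in_correlated_plane (d : Fin 3 → ℕ) (S : Fin 3 → Matrix (Fin 3) (Fin 3) ℝ) (hS : ∀ l, (S l).IsSymm)
    (h0 : d 0 = 0) (hS0 : S 0 = 1) (hd1 : d 1 < d 2) (hd : d 2 < 2 * d 1)
    (P : Matrix (Fin 2) (Fin 3) ℝ) (hP : P * Pᵀ = 1)
    (hcorr : 0 ≤ ((P * S 1 * Pᵀ) 0 0 - (P * S 1 * Pᵀ) 1 1) * ((P * S 2 * Pᵀ) 0 0 - (P * S 2 * Pᵀ) 1 1)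
      + 4 * ((P * S 1 * Pᵀ) 0 1 * (P * S 2 * Pᵀ) 0 1))
    {x : Fin 4 → ℝ} (hx0 : 0 < x 0) (hx : StrictMono x)
    (hpsd : ∀ i, (∑ l, x i ^ d l • S l).PosSemidef)
    {v : Fin 4 → Fin 2 → ℝ} (hv : ∀ i, v i ≠ 0) (hker : ∀ i, (∑ l, x i ^ d l • S l) *ᵥ (Pᵀ *ᵥ v i) = 0) : False := by
  set S' : Fin 3 → Matrix (Fin 2) (Fin 2) ℝ := fun l => P * S l * Pᵀ with hS'
  have hS'symm : ∀ l, (S' l).IsSymm := fun l => by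
    show (P * S l * Pᵀ).IsSymm
    unfold Matrix.IsSymm
    rw [Matrix.transpose_mul, Matrix.transpose_mul, Matrix.transpose_transpose, (hS l).eq, Matrix.mul_assoc]
  have hS'0 : S' 0 = 1 := by show P * S 0 * Pᵀ = 1; rw [hS0, Matrix.mul_one, hP]
  have hcongr : ∀ t : ℝ, (∑ l, t ^ d l • S' l) = P * (∑ l, t ^ d l • S l) * Pᵀ := fun t => eval_pencil_compress d S P Pᵀ t
  refine no_four_psdSingular_of_correlated d S' hS'symm h0 hS'0 hd1 hd hcorr hx0 hx (fun i => ?_) (fun i => ?_)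
  · rw [hcongr, ← Matrix.conjTranspose_eq_transpose_of_trivial]
    exact (hpsd i).mul_mul_conjTranspose_same P
  · rw [hcongr]
    refine (Matrix.exists_mulVec_eq_zero_iff).mp ⟨v i, hv i, ?_⟩
    rw [← Matrix.mulVec_mulVec, ← Matrix.mulVec_mulVec, hker i, Matrix.mulVec_zero]

end EndLetterTwo

end Summit.ValiantsHypothesis.ValiantsHypothesis.Theorems.LacunarySymmetroidMatrixDescartes.Census
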